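import Summits.CriticalPhenomena.SAWScalingLimit.Theses.SAWWeldingIdentification
import Summits.CriticalPhenomena.SAWScalingLimit.Theses.SAWLoopFugacityFlow
import Summits.CriticalPhenomena.SAWScalingLimit.Theorems.SAWWeldingIdentificationWeldingSetup
import Summits.CriticalPhenomena.SAWScalingLimit.Theorems.SAWWeldingIdentificationSLERemovableChord
import Summits.CriticalPhenomena.SAWScalingLimit.Theorems.SAWWeldingIdentificationWeldingRigidity
import Summits.CriticalPhenomena.SAWScalingLimit.Theorems.SAWWeldingIdentificationIdentifyFromWelding
import Literature.Probability.RandomPlanarGeometry.ConformalWelding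

/-!
# `WeldingLawOfLimit` (stmt-CriticalPhenomena-4502) in the item graph of `SAWScalingLimit`

Route `SAWWeldingIdentification`, crux (W) `WeldingLawOfLimit`. Support file of the crux line
`registered` (skeleton `Cruxes/WeldingLawOfLimit/Lines/birth.lean`), all sorry-free:
* `weldingLawOfLimit_of_subseqIdentification`: the SHARED crux `SubseqIdentification`
  (stmt-CriticalPhenomena-0783) implies (W), by uniqueness in law of chordal SLE (`IsSLECurve.map_eq`).
* `ae_isSimpleChord_of_weldingLawOfLimit`: (W) implies chord support of every subsequential limit
  (stub 1 of the line = the `D := Q.chord 0 2` instance of the shared crux `SimpleSubseqLimits`,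
  stmt-CriticalPhenomena-4982): `W` is free off the Borel set of simple chords (refuters' route review
  rreview-61058af5, R1 strength note, made formal).
* `map_conformalWelding_eq_of_weldingLawOfLimit`: (W) for the canonical welding `conformalWelding`.
* `weldingLawOfLimit_of_chordSupport_of_canonical`: chord support + canonical welding law give (W)
  (the skeleton's composition, hypotheses inlined); so (W) <=> ChordSupport /\ CanonicalWeldingLaw.
* `ae_isSimpleChord_of_simpleSubseqLimits`: stmt-4982 gives stub 1.
* `isSLELaw_of_weldingLawOfLimit_of_removableLimit`, `subseqIdentification_of_weldingLawOfLimit`: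
  (W) with the sibling crux `RemovableLimit` (stmt-CriticalPhenomena-4503) gives back stmt-0783 (core
  of the route's deciding theorem `closes`, tightness removed): modulo (R), (W) <=> stmt-0783.
No new definition, no named fact.
-/

noncomputable section

open MeasureTheory Filter Topology Set
open Literature.Probability.RandomPlanarGeometry Literature.Probability.LatticeModels
open Literature.Probability.Process (preWienerMeasure)
open UpperHalfPlane (upperHalfPlaneSet)
open Summit.CriticalPhenomena.SAWScalingLimit.Theses

namespace Summit.CriticalPhenomena.SAWScalingLimit.Theorems.WeldingLawOfLimit

/-! ### Small helpers -/

/-- A positive sequence tending to `0` tends to `0` within `(0, ∞)`. [folklore] -/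
theorem tendsto_nhdsWithin_Ioi_of_pos {δs : ℕ → ℝ} (hpos : ∀ n, 0 < δs n)
    (hδ : Tendsto δs atTop (𝓝 0)) : Tendsto δs atTop (𝓝[>] (0 : ℝ)) :=
  tendsto_nhdsWithin_iff.2 ⟨hδ, Eventually.of_forall fun n => mem_Ioi.2 (hpos n)⟩

/-- Chordal SLE_{8/3} in `(Ω; a, b) = Q.chord 0 2` is carried by the simple chords of `(Ω; a, b)`:
Rohde–Schramm 2005 Thm 6.1 in the tree's form `SLERemovableChord_proof`, transported to the image
measure through the Borel set of simple chords (`measurableSet_isSimpleChord`). [folklore] -/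
theorem ae_isSimpleChord_map_sle (Q : ConformalRectangle) {Γ : (NNReal → ℝ) → CurveClass ℂ}
    (hΓ : IsSLECurve ((8 : NNReal) / 3) (Q.chord 0 2 (by decide)) Γ) :
    ∀ᵐ γ ∂(preWienerMeasure.map Γ), (Q.chord 0 2 (by decide)).IsSimpleChord γ :=
  (ae_map_iff hΓ.1 (measurableSet_isSimpleChord Q)).2
    ((SLERemovableChord_proof Q Γ hΓ).mono fun _ hω => hω.1)

/-- On a simple chord the canonical welding is positive at every `x > 0` (a welding configuration
exists by `WeldingSetup_proof` (i), and `weldingSetup_partII`). [folklore] -/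
theorem conformalWelding_pos_of_isSimpleChord (Q : ConformalRectangle) {γ : CurveClass ℂ}
    (hγ : (Q.chord 0 2 (by decide)).IsSimpleChord γ) {x : ℝ} (hx : 0 < x) :
    0 < conformalWelding Q γ x := by
  obtain ⟨hsign, -⟩ := WeldingSetup_proof
  obtain ⟨s, hs, hconf⟩ := hsign Q
  obtain ⟨L, R, φ, ψ, hb, hn⟩ := hconf γ hγ
  exact (weldingSetup_partII Q γ s L R φ ψ hγ hs hb hn x hx).1

/-! ### `SubseqIdentification` (stmt-0783) implies the crux -/

/-- **stmt-0783 ⇒ stmt-4502.** If every subsequential weak limit of the critical SAW laws is a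
chordal SLE_{8/3} law (`SubseqIdentification`, shared crux stmt-CriticalPhenomena-0783), then the
welding law of every subsequential limit is the SLE_{8/3} welding law for EVERY functional `W`
(`WeldingLawOfLimit`): `P = ℙ ∘ Γ₀⁻¹` for some SLE curve `Γ₀`, and `ℙ ∘ Γ₀⁻¹ = ℙ ∘ Γ⁻¹` by the
antecedent `IsSLECurve.map_eq` (uniqueness in law of chordal SLE). [folklore] -/
theorem weldingLawOfLimit_of_subseqIdentification :
    SAWLoopFugacityFlow.SubseqIdentification → SAWWeldingIdentification.WeldingLawOfLimit := by
  intro h hmap W _hWpin _hWmeas Q a b hab P hP δs hpos hδ hlim Γ hΓ k x _hx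
  obtain ⟨Γ₀, hΓ₀, hPΓ₀⟩ :=
    h (Q.chord 0 2 (by decide)) a b hab δs P (tendsto_nhdsWithin_Ioi_of_pos hpos hδ) hP hlim
  rw [hPΓ₀, hmap hΓ₀ hΓ]

/-! ### The crux implies chord support and the canonical welding law -/

/-- **(W) specialised to the canonical welding.** Under `WeldingLawOfLimit`, for every subsequential
weak limit `P` and every chordal SLE_{8/3} curve `Γ` in `(Ω; a, b)`, the finite-dimensional laws of
the Literature welding `conformalWelding Q γ` at positive points agree under `P` and `ℙ ∘ Γ⁻¹`
(`conformalWelding` is pinned on chords, `weldingSetup_partII`, and Borel, `measurable_conformalWelding`;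
the antecedent `IsSLECurve.map_eq` is the theorem `IsSLECurve.map_eq_holds`). [folklore] -/
theorem map_conformalWelding_eq_of_weldingLawOfLimit (h : SAWWeldingIdentification.WeldingLawOfLimit)
    (Q : ConformalRectangle) (a b : ℝ → Site 2)
    (hab : SAW.IsEndpointApprox (Q.chord 0 2 (by decide)) a b)
    (P : Measure (CurveClass ℂ)) (hP : IsProbabilityMeasure P)
    (δs : ℕ → ℝ) (hpos : ∀ n, 0 < δs n) (hδ : Tendsto δs atTop (𝓝 0))
    (hlim : ∀ f : BoundedContinuousFunction (CurveClass ℂ) ℝ,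
      Tendsto (fun n => ∫ γ, f γ.curve ∂(SAW.law Q.carrier (δs n) (a (δs n)) (b (δs n))))
        atTop (𝓝 (∫ γ, f γ ∂P)))
    (Γ : (NNReal → ℝ) → CurveClass ℂ) (hΓ : IsSLECurve ((8 : NNReal) / 3) (Q.chord 0 2 (by decide)) Γ)
    (k : ℕ) (x : Fin k → ℝ) (hx : ∀ i, 0 < x i) :
    P.map (fun γ i => conformalWelding Q γ (x i)) =
      (preWienerMeasure.map Γ).map (fun γ i => conformalWelding Q γ (x i)) :=
  h IsSLECurve.map_eq_holds conformalWelding weldingSetup_partII measurable_conformalWelding Q a b hab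
    P hP δs hpos hδ hlim Γ hΓ k x hx

/-- **(W) forces chord support of every subsequential limit** (refuters' R1 strength note,
rreview-61058af5, made formal): under `WeldingLawOfLimit`, `P`-almost every curve class of a
subsequential weak limit `P` of the critical SAW laws in `(Q.chord 0 2; a_δ, b_δ)` is a simple chord
of `(Ω; a, b)`. Proof: both `W₀ := conformalWelding` and `W₁ := conformalWelding + 𝟙(not a chord)`
are pinned and Borel; their one-point laws at `x = 1` under `P` both equal the corresponding laws
under the SLE law `ℙ ∘ Γ⁻¹` (an SLE curve exists, `ChordalSLE83Exists_holds`), which coincide because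
`ℙ ∘ Γ⁻¹` is carried by chords; but `{W₀ = 0}` is the set of non-chords while `{W₁ = 0} = ∅`. [folklore] -/
theorem ae_isSimpleChord_of_weldingLawOfLimit (h : SAWWeldingIdentification.WeldingLawOfLimit)
    (Q : ConformalRectangle) (a b : ℝ → Site 2)
    (hab : SAW.IsEndpointApprox (Q.chord 0 2 (by decide)) a b)
    (P : Measure (CurveClass ℂ)) (hP : IsProbabilityMeasure P)
    (δs : ℕ → ℝ) (hpos : ∀ n, 0 < δs n) (hδ : Tendsto δs atTop (𝓝 0))
    (hlim : ∀ f : BoundedContinuousFunction (CurveClass ℂ) ℝ,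
      Tendsto (fun n => ∫ γ, f γ.curve ∂(SAW.law Q.carrier (δs n) (a (δs n)) (b (δs n))))
        atTop (𝓝 (∫ γ, f γ ∂P))) :
    ∀ᵐ γ ∂P, (Q.chord 0 2 (by decide)).IsSimpleChord γ := by
  classical
  -- buildfix 2026-08-19: `SAWWeldingIdentification.ChordalSLE83Exists_holds` is no longer linked in the route file;
  -- the tree theorem it unfolded to (Rohde–Schramm existence, `exists_isSLECurve_eightThirds`) is cited directly.
  obtain ⟨Γ, hΓ⟩ := Literature.Probability.RandomPlanarGeometry.exists_isSLECurve_eightThirds (Q.chord 0 2 (by decide))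
  -- the set of simple chords of `(Q'.carrier; Q'.pt 0, Q'.pt 2)`
  set S : ConformalRectangle → Set (CurveClass ℂ) :=
    fun Q' => {γ | (Q'.chord 0 2 (by decide)).IsSimpleChord γ} with hS
  have hSm : ∀ Q', MeasurableSet (S Q') := fun Q' => measurableSet_isSimpleChord Q'
  -- the second pinned functional
  set W₁ : ConformalRectangle → CurveClass ℂ → ℝ → ℝ :=
    fun Q' γ y => conformalWelding Q' γ y + (S Q')ᶜ.indicator 1 γ with hW₁
  have hW₁S : ∀ (Q' : ConformalRectangle) (γ : CurveClass ℂ) (y : ℝ), γ ∈ S Q' →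
      W₁ Q' γ y = conformalWelding Q' γ y := by
    intro Q' γ y hγ
    simp only [hW₁, indicator_of_notMem (notMem_compl_iff.2 hγ), add_zero]
  have hW₁pin : ∀ (Q' : ConformalRectangle) (γ : CurveClass ℂ) (s : ℝ) (L R : Set ℂ)
      (φ : ConformalEquiv upperHalfPlaneSet L) (ψ : ConformalEquiv upperHalfPlaneSet R),
      (γ ∈ CurveClass.simple ∧ γ.source = Q'.pt 0 ∧ γ.target = Q'.pt 2 ∧
        γ.range ⊆ closure Q'.carrier ∧ γ.range ∩ frontier Q'.carrier ⊆ {Q'.pt 0, Q'.pt 2}) →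
      (s = 1 ∨ s = -1) →
      (L ∪ R = Q'.carrier \ γ.range ∧ Disjoint L R ∧ IsOpen L ∧ IsOpen R ∧ IsConnected L ∧
        IsConnected R ∧ Q'.pt 1 ∈ closure L ∧ Q'.pt 3 ∈ closure R) →
      (φ.HasBoundaryValue 0 (Q'.pt 0) ∧ φ.HasBoundaryValueAtInfty (Q'.pt 2) ∧
        φ.HasBoundaryValue ((s : ℝ) : ℂ) (Q'.pt 1) ∧ ψ.HasBoundaryValue 0 (Q'.pt 0) ∧
        ψ.HasBoundaryValueAtInfty (Q'.pt 2) ∧ ψ.HasBoundaryValue (-((s : ℝ) : ℂ)) (Q'.pt 3)) →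
      ∀ y : ℝ, 0 < y → 0 < W₁ Q' γ y ∧
        ψ.boundaryExtension (((s * y : ℝ)) : ℂ) =
          φ.boundaryExtension (((-(s * W₁ Q' γ y) : ℝ)) : ℂ) := by
    intro Q' γ s L R φ ψ hγ hs hb hn y hy
    rw [hW₁S Q' γ y hγ]
    exact weldingSetup_partII Q' γ s L R φ ψ hγ hs hb hn y hy
  have hW₁meas : ∀ (Q' : ConformalRectangle) (y : ℝ), Measurable fun γ : CurveClass ℂ => W₁ Q' γ y :=
    fun Q' y => (measurable_conformalWelding Q' y).add (measurable_one.indicator (hSm Q').compl)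
  -- the two one-point laws at `x = 1`
  set F₀ : CurveClass ℂ → Fin 1 → ℝ := fun γ _ => conformalWelding Q γ 1 with hF₀
  set F₁ : CurveClass ℂ → Fin 1 → ℝ := fun γ _ => W₁ Q γ 1 with hF₁
  have hF₀m : Measurable F₀ := measurable_pi_lambda _ fun _ => measurable_conformalWelding Q 1
  have hF₁m : Measurable F₁ := measurable_pi_lambda _ fun _ => hW₁meas Q 1
  have h₀ : P.map F₀ = (preWienerMeasure.map Γ).map F₀ :=
    h IsSLECurve.map_eq_holds conformalWelding weldingSetup_partII measurable_conformalWelding Q a b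
      hab P hP δs hpos hδ hlim Γ hΓ 1 (fun _ => 1) fun _ => one_pos
  have h₁ : P.map F₁ = (preWienerMeasure.map Γ).map F₁ :=
    h IsSLECurve.map_eq_holds W₁ hW₁pin hW₁meas Q a b hab P hP δs hpos hδ hlim Γ hΓ 1 (fun _ => 1)
      fun _ => one_pos
  -- under the SLE law the two functionals agree almost surely
  have hμ : (preWienerMeasure.map Γ).map F₀ = (preWienerMeasure.map Γ).map F₁ := by
    refine Measure.map_congr ?_
    filter_upwards [ae_isSimpleChord_map_sle Q hΓ] with γ hγ
    funext i
    simp only [hF₀, hF₁, hW₁S Q γ 1 hγ]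
  have hP01 : P.map F₀ = P.map F₁ := by rw [h₀, hμ, ← h₁]
  -- evaluate at `{v | v 0 = 0}`
  set A : Set (Fin 1 → ℝ) := (fun v : Fin 1 → ℝ => v 0) ⁻¹' {0} with hA
  have hAm : MeasurableSet A := measurable_pi_apply (0 : Fin 1) (measurableSet_singleton (0 : ℝ))
  have hpre₀ : F₀ ⁻¹' A = (S Q)ᶜ := by
    ext γ
    simp only [hA, hF₀, mem_preimage, mem_singleton_iff, mem_compl_iff]
    constructor
    · intro h0 hγ
      exact (conformalWelding_pos_of_isSimpleChord Q hγ one_pos).ne' h0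
    · intro hγ
      rw [conformalWelding_of_not_isSimpleChord hγ, Pi.zero_apply]
  have hpre₁ : F₁ ⁻¹' A = ∅ := by
    ext γ
    simp only [hA, hF₁, mem_preimage, mem_singleton_iff, mem_empty_iff_false, iff_false]
    by_cases hγ : γ ∈ S Q
    · rw [hW₁S Q γ 1 hγ]
      exact (conformalWelding_pos_of_isSimpleChord Q hγ one_pos).ne'
    · have : W₁ Q γ 1 = 1 := by
        simp only [hW₁, indicator_of_mem (mem_compl hγ), Pi.one_apply,
          conformalWelding_of_not_isSimpleChord hγ, Pi.zero_apply, zero_add]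
      rw [this]
      exact one_ne_zero
  have hPS : P (S Q)ᶜ = 0 := by
    have := congrArg (fun ν : Measure (Fin 1 → ℝ) => ν A) hP01
    simp only [Measure.map_apply hF₀m hAm, Measure.map_apply hF₁m hAm, hpre₀, hpre₁,
      measure_empty] at this
    exact this
  rw [ae_iff]
  exact hPS

/-! ### Conversely: chord support + canonical welding law give the crux -/

/-- A functional pinned on simple chords by the normalised uniformisers (the hypothesis of the
crux, verbatim) coincides with `conformalWelding` on every simple chord at every `x > 0`
(configuration existence `WeldingSetup_proof` (i) + uniqueness `conformalWelding_eq_of_isWeld`). [folklore] -/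
theorem eq_conformalWelding_of_pinned
    (W : ConformalRectangle → CurveClass ℂ → ℝ → ℝ)
    (hWpin : ∀ (Q : ConformalRectangle) (γ : CurveClass ℂ) (s : ℝ) (L R : Set ℂ)
      (φ : ConformalEquiv upperHalfPlaneSet L) (ψ : ConformalEquiv upperHalfPlaneSet R),
      (γ ∈ CurveClass.simple ∧ γ.source = Q.pt 0 ∧ γ.target = Q.pt 2 ∧
        γ.range ⊆ closure Q.carrier ∧ γ.range ∩ frontier Q.carrier ⊆ {Q.pt 0, Q.pt 2}) →
      (s = 1 ∨ s = -1) →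
      (L ∪ R = Q.carrier \ γ.range ∧ Disjoint L R ∧ IsOpen L ∧ IsOpen R ∧ IsConnected L ∧
        IsConnected R ∧ Q.pt 1 ∈ closure L ∧ Q.pt 3 ∈ closure R) →
      (φ.HasBoundaryValue 0 (Q.pt 0) ∧ φ.HasBoundaryValueAtInfty (Q.pt 2) ∧
        φ.HasBoundaryValue ((s : ℝ) : ℂ) (Q.pt 1) ∧ ψ.HasBoundaryValue 0 (Q.pt 0) ∧
        ψ.HasBoundaryValueAtInfty (Q.pt 2) ∧ ψ.HasBoundaryValue (-((s : ℝ) : ℂ)) (Q.pt 3)) →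
      ∀ x : ℝ, 0 < x → 0 < W Q γ x ∧
        ψ.boundaryExtension (((s * x : ℝ)) : ℂ) =
          φ.boundaryExtension (((-(s * W Q γ x) : ℝ)) : ℂ))
    (Q : ConformalRectangle) {γ : CurveClass ℂ} (hγ : (Q.chord 0 2 (by decide)).IsSimpleChord γ)
    {x : ℝ} (hx : 0 < x) : W Q γ x = conformalWelding Q γ x := by
  obtain ⟨hsign, -⟩ := WeldingSetup_proof
  obtain ⟨s, hs, hconf⟩ := hsign Q
  obtain ⟨L, R, φ, ψ, hb, hn⟩ := hconf γ hγ
  obtain ⟨-, hw⟩ := hWpin Q γ s L R φ ψ hγ hs hb hn x hx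
  exact (conformalWelding_eq_of_isWeld hγ ⟨s, L, R, φ, ψ, hs, hb, hn⟩ hx hw).symm

/-- **ChordSupport ∧ CanonicalWeldingLaw ⇒ (W)** — the composition of the line's skeleton with its
two stub statements inlined as hypotheses: if every subsequential weak limit of the critical SAW
laws in `(Q.chord 0 2; a_δ, b_δ)` is carried by simple chords (`hS`), and for chord-supported limits
the finite-dimensional laws of `conformalWelding` agree with those of chordal SLE_{8/3} (`hC`), then
`WeldingLawOfLimit` holds: any pinned `W` equals `conformalWelding` almost surely on both sides
(`eq_conformalWelding_of_pinned`, `ae_isSimpleChord_map_sle`, `Measure.map_congr`). Together with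
`ae_isSimpleChord_of_weldingLawOfLimit` and `map_conformalWelding_eq_of_weldingLawOfLimit` this is
the equivalence (W) ⟺ ChordSupport ∧ CanonicalWeldingLaw. [folklore] -/
theorem weldingLawOfLimit_of_chordSupport_of_canonical
    (hS : ∀ (Q : ConformalRectangle) (a b : ℝ → Site 2),
      SAW.IsEndpointApprox (Q.chord 0 2 (by decide)) a b →
      ∀ (P : Measure (CurveClass ℂ)), IsProbabilityMeasure P →
      ∀ (δs : ℕ → ℝ), (∀ n, 0 < δs n) → Tendsto δs atTop (𝓝 0) →
      (∀ f : BoundedContinuousFunction (CurveClass ℂ) ℝ,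
        Tendsto (fun n => ∫ γ, f γ.curve ∂(SAW.law Q.carrier (δs n) (a (δs n)) (b (δs n))))
          atTop (𝓝 (∫ γ, f γ ∂P))) →
      ∀ᵐ γ ∂P, (Q.chord 0 2 (by decide)).IsSimpleChord γ)
    (hC : ∀ (Q : ConformalRectangle) (a b : ℝ → Site 2),
      SAW.IsEndpointApprox (Q.chord 0 2 (by decide)) a b →
      ∀ (P : Measure (CurveClass ℂ)), IsProbabilityMeasure P →
      ∀ (δs : ℕ → ℝ), (∀ n, 0 < δs n) → Tendsto δs atTop (𝓝 0) →
      (∀ f : BoundedContinuousFunction (CurveClass ℂ) ℝ,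
        Tendsto (fun n => ∫ γ, f γ.curve ∂(SAW.law Q.carrier (δs n) (a (δs n)) (b (δs n))))
          atTop (𝓝 (∫ γ, f γ ∂P))) →
      (∀ᵐ γ ∂P, (Q.chord 0 2 (by decide)).IsSimpleChord γ) →
      ∀ Γ : (NNReal → ℝ) → CurveClass ℂ, IsSLECurve ((8 : NNReal) / 3) (Q.chord 0 2 (by decide)) Γ →
      ∀ (k : ℕ) (x : Fin k → ℝ), (∀ i, 0 < x i) →
        P.map (fun γ i => conformalWelding Q γ (x i)) =
          (preWienerMeasure.map Γ).map (fun γ i => conformalWelding Q γ (x i))) :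
    SAWWeldingIdentification.WeldingLawOfLimit := by
  intro _hmap W hWpin _hWmeas Q a b hab P hP δs hpos hδ hlim Γ hΓ k x hx
  have hPch : ∀ᵐ γ ∂P, (Q.chord 0 2 (by decide)).IsSimpleChord γ :=
    hS Q a b hab P hP δs hpos hδ hlim
  have hWP : (fun γ (i : Fin k) => W Q γ (x i)) =ᵐ[P] fun γ i => conformalWelding Q γ (x i) :=
    hPch.mono fun γ hγ => funext fun i => eq_conformalWelding_of_pinned W hWpin Q hγ (hx i)
  have hWμ : (fun γ (i : Fin k) => W Q γ (x i)) =ᵐ[preWienerMeasure.map Γ]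
      fun γ i => conformalWelding Q γ (x i) :=
    (ae_isSimpleChord_map_sle Q hΓ).mono fun γ hγ =>
      funext fun i => eq_conformalWelding_of_pinned W hWpin Q hγ (hx i)
  rw [Measure.map_congr hWP, Measure.map_congr hWμ]
  exact hC Q a b hab P hP δs hpos hδ hlim hPch Γ hΓ k x hx

/-! ### Stub 1 of the line is the chord instance of `SimpleSubseqLimits` (stmt-4982) -/

/-- **stmt-4982 ⇒ ChordSupport.** The shared crux `SimpleSubseqLimits` (every subsequential weak
limit of the critical SAW laws in a Dobrushin domain is carried by simple chords), instantiated at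
`D := Q.chord 0 2`, is exactly chord support of subsequential limits in the binders of the crux
(`(∀ n, 0 < δs n) ∧ δs → 0` gives `δs → 0` within `(0, ∞)`). [folklore] -/
theorem ae_isSimpleChord_of_simpleSubseqLimits (h : SAWLoopFugacityFlow.SimpleSubseqLimits)
    (Q : ConformalRectangle) (a b : ℝ → Site 2)
    (hab : SAW.IsEndpointApprox (Q.chord 0 2 (by decide)) a b)
    (P : Measure (CurveClass ℂ)) (hP : IsProbabilityMeasure P)
    (δs : ℕ → ℝ) (hpos : ∀ n, 0 < δs n) (hδ : Tendsto δs atTop (𝓝 0))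
    (hlim : ∀ f : BoundedContinuousFunction (CurveClass ℂ) ℝ,
      Tendsto (fun n => ∫ γ, f γ.curve ∂(SAW.law Q.carrier (δs n) (a (δs n)) (b (δs n))))
        atTop (𝓝 (∫ γ, f γ ∂P))) :
    ∀ᵐ γ ∂P, (Q.chord 0 2 (by decide)).IsSimpleChord γ :=
  h (Q.chord 0 2 (by decide)) a b hab δs P (tendsto_nhdsWithin_Ioi_of_pos hpos hδ) hP hlim

/-! ### (W) ∧ (R) ⇒ `SubseqIdentification` -/

/-- **(W) ∧ (R) identify every subsequential limit with the SLE_{8/3} law** (core of the route's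
deciding theorem `closes`, tightness removed): under `WeldingLawOfLimit` and `RemovableLimit`, every
subsequential weak limit `P` of the critical SAW laws in `(Q.chord 0 2; a_δ, b_δ)` along a positive
sequence `δₙ → 0` is a chordal SLE_{8/3} law in `(Ω; a, b)`. Ingredients, all proved in tree: an SLE
curve `Γ` (`ChordalSLE83Exists_holds`), the welding set-up and rigidity (`WeldingSetup_proof`,
`weldingRigidity_proof`), removability of SLE_{8/3} chords (`SLERemovableChord_proof`) and the
Lusin–Souslin identification (`identifyFromWelding_proof`). [folklore] -/
theorem isSLELaw_of_weldingLawOfLimit_of_removableLimit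
    (hW : SAWWeldingIdentification.WeldingLawOfLimit) (hR : SAWWeldingIdentification.RemovableLimit)
    (Q : ConformalRectangle) (a b : ℝ → Site 2)
    (hab : SAW.IsEndpointApprox (Q.chord 0 2 (by decide)) a b)
    (P : Measure (CurveClass ℂ)) (hP : IsProbabilityMeasure P)
    (δs : ℕ → ℝ) (hpos : ∀ n, 0 < δs n) (hδ : Tendsto δs atTop (𝓝 0))
    (hlim : ∀ f : BoundedContinuousFunction (CurveClass ℂ) ℝ,
      Tendsto (fun n => ∫ γ, f γ.curve ∂(SAW.law Q.carrier (δs n) (a (δs n)) (b (δs n))))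
        atTop (𝓝 (∫ γ, f γ ∂P))) :
    IsSLELaw ((8 : NNReal) / 3) (Q.chord 0 2 (by decide)) P := by
  -- buildfix 2026-08-19: `SAWWeldingIdentification.ChordalSLE83Exists_holds` is no longer linked in the route file;
  -- the tree theorem it unfolded to (Rohde–Schramm existence, `exists_isSLECurve_eightThirds`) is cited directly.
  obtain ⟨Γ, hΓ⟩ := Literature.Probability.RandomPlanarGeometry.exists_isSLECurve_eightThirds (Q.chord 0 2 (by decide))
  refine ⟨Γ, hΓ, ?_⟩
  haveI : IsProbabilityMeasure preWienerMeasure :=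
    Literature.Probability.RandomPlanarGeometry.isProbabilityMeasure_preWienerMeasure'
  have hΓm : AEMeasurable Γ preWienerMeasure := hΓ.1
  obtain ⟨hsign, W, hWmeas, hWpin⟩ := WeldingSetup_proof
  obtain ⟨s, hs, hconf⟩ := hsign Q
  refine identifyFromWelding_proof Q W P (NNReal → ℝ) preWienerMeasure Γ hP inferInstance hΓm hWmeas
    ?_ ?_ ?_ ?_
  · -- `P`-a.s. the limit curve is a removable simple chord (R)
    exact hR Q a b hab P hP δs hpos hδ hlim
  · -- a.s. the SLE_{8/3} curve is a removable simple chord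
    exact SLERemovableChord_proof Q Γ hΓ
  · -- the welding separates removable chords (set-up + rigidity)
    intro γ γ' hγ hγ' heq
    obtain ⟨L, R, φ, ψ, hb, hn⟩ := hconf γ hγ.1
    obtain ⟨L', R', φ', ψ', hb', hn'⟩ := hconf γ' hγ'.1
    refine WeldingRigidity.weldingRigidity_proof Q γ γ' s L R L' R' φ ψ φ' ψ' (fun q => W Q γ q)
      hγ.1 hγ'.1 hγ.2 hs hb hb' hn hn' ?_
    intro q hq
    have hq' : (0 : ℝ) < (q : ℝ) := by exact_mod_cast hq
    obtain ⟨hpos₁, hw₁⟩ := hWpin Q γ s L R φ ψ hγ.1 hs hb hn q hq'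
    obtain ⟨-, hw₂⟩ := hWpin Q γ' s L' R' φ' ψ' hγ'.1 hs hb' hn' q hq'
    refine ⟨hpos₁, hw₁, ?_⟩
    rw [heq q hq]
    exact hw₂
  · -- the welding laws agree (W), at positive rational points
    intro k x hx
    exact hW IsSLECurve.map_eq_holds W hWpin hWmeas Q a b hab P hP δs hpos hδ hlim Γ hΓ k
      (fun i => (x i : ℝ)) (fun i => by exact_mod_cast hx i)

/-- **stmt-4502 ∧ stmt-4503 ⇒ stmt-0783.** `WeldingLawOfLimit` and `RemovableLimit` imply the shared
crux `SubseqIdentification`: every Dobrushin domain `D` is `Q.chord 0 2` for a conformal rectangle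
`Q` (insert one mark in each open boundary arc), and a sequence `sₙ → 0` within `(0, ∞)` may be made
positive by changing finitely many terms, which changes neither the limit of the integrals nor the
conclusion. With `weldingLawOfLimit_of_subseqIdentification`: modulo (R), (W) ⟺ stmt-0783. [folklore] -/
theorem subseqIdentification_of_weldingLawOfLimit :
    SAWWeldingIdentification.WeldingLawOfLimit → SAWWeldingIdentification.RemovableLimit →
      SAWLoopFugacityFlow.SubseqIdentification := by
  intro hW hR D a b hab s μ hs hμ hlim
  -- Step 0. Complete `D = (Ω; a, b)` to a conformal rectangle `Q` with `Q.chord 0 2 = D`.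
  obtain ⟨Q, rfl⟩ : ∃ Q : ConformalRectangle, Q.chord 0 2 (by decide) = D := by
    obtain ⟨J, m, hm, hmem⟩ := D
    have h01 : m 0 < m 1 := hm (show (0 : Fin 2) < 1 by decide)
    have h0 : 0 ≤ m 0 ∧ m 0 < 1 := hmem 0
    have h1 : 0 ≤ m 1 ∧ m 1 < 1 := hmem 1
    refine ⟨⟨J, ![m 0, (m 0 + m 1) / 2, m 1, (m 1 + 1) / 2], ?_, ?_⟩, ?_⟩
    · refine Fin.strictMono_iff_lt_succ.2 fun k => ?_
      fin_cases k
      · show m 0 < (m 0 + m 1) / 2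
        linarith
      · show (m 0 + m 1) / 2 < m 1
        linarith
      · show m 1 < (m 1 + 1) / 2
        linarith
    · intro k
      fin_cases k
      · show m 0 ∈ Set.Ico (0 : ℝ) 1
        exact hmem 0
      · show (m 0 + m 1) / 2 ∈ Set.Ico (0 : ℝ) 1
        exact ⟨by linarith, by linarith⟩
      · show m 1 ∈ Set.Ico (0 : ℝ) 1
        exact hmem 1
      · show (m 1 + 1) / 2 ∈ Set.Ico (0 : ℝ) 1
        exact ⟨by linarith, by linarith⟩
    · simp only [Literature.Probability.RandomPlanarGeometry.MarkedDomain.chord]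
      congr 1
      funext k
      fin_cases k <;> rfl
  -- Step 1. Make the mesh sequence positive (it is eventually positive).
  have hev : ∀ᶠ n in atTop, 0 < s n := hs.eventually (eventually_mem_nhdsWithin)
  set s' : ℕ → ℝ := fun n => if 0 < s n then s n else 1 with hs'
  have hs'pos : ∀ n, 0 < s' n := fun n => by
    by_cases hn : 0 < s n
    · simp only [hs', if_pos hn]; exact hn
    · simp only [hs', if_neg hn]; exact one_pos
  have heq : ∀ᶠ n in atTop, s' n = s n := hev.mono fun n hn => if_pos hn
  have hs'0 : Tendsto s' atTop (𝓝 0) :=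
    (tendsto_nhdsWithin_iff.1 hs).1.congr' (heq.mono fun n hn => hn.symm)
  have key : ∀ f : BoundedContinuousFunction (CurveClass ℂ) ℝ,
      (fun n => ∫ γ, f γ.curve ∂(SAW.law Q.carrier (s n) (a (s n)) (b (s n)))) =ᶠ[atTop]
        fun n => ∫ γ, f γ.curve ∂(SAW.law Q.carrier (s' n) (a (s' n)) (b (s' n))) := fun f =>
    heq.mono fun n hn =>
      congrArg (fun δ : ℝ => ∫ γ, f γ.curve ∂(SAW.law Q.carrier δ (a δ) (b δ))) hn.symm
  have hlim' : ∀ f : BoundedContinuousFunction (CurveClass ℂ) ℝ,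
      Tendsto (fun n => ∫ γ, f γ.curve ∂(SAW.law Q.carrier (s' n) (a (s' n)) (b (s' n))))
        atTop (𝓝 (∫ γ, f γ ∂μ)) := fun f => (hlim f).congr' (key f)
  exact isSLELaw_of_weldingLawOfLimit_of_removableLimit hW hR Q a b hab μ hμ s' hs'pos hs'0 hlim'

end Summit.CriticalPhenomena.SAWScalingLimit.Theorems.WeldingLawOfLimit

end
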